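import Summits.HodgeConjecture.HodgeConjecture.Theorems.F0P6aDatumOfInputsDefs
import Summits.HodgeConjecture.HodgeConjecture.Theorems.F0P6aRoofKernelCount
import Summits.HodgeConjecture.HodgeConjecture.Theorems.F0P6cHeckeBacktrack
import Literature.AlgebraicGeometry.AbelianSchemes.RoofDegreeIdentity
import Literature.AlgebraicGeometry.AbelianSchemes.IdealTorsionPointCountAlgClosedField
import Literature.AlgebraicGeometry.AbelianSchemes.PoincareSheafMulN
import Literature.AlgebraicGeometry.AbelianSchemes.RoofKernelIdealTorsion
import Literature.AlgebraicGeometry.AbelianSchemes.DualIsogenyKernel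
import Literature.FieldTheory.AlgClosed.PadicAlgClosureEmbedsComplex
import Literature.AlgebraicGeometry.AbelianSchemes.IdealTorsionPointsCoprimeSplitting
import Summits.HodgeConjecture.HodgeConjecture.Theorems.F0P6aLineSpecialisation
import Literature.AlgebraicGeometry.AbelianSchemes.RoofLegsSpecialFibre
import Literature.AlgebraicGeometry.AbelianSchemes.SerreTensorUntwistBaseChange
import Literature.AlgebraicGeometry.AbelianSchemes.RoofTargetUnique
import Literature.AlgebraicGeometry.AbelianSchemes.RoofLegsIsogenyOfPolarization
import Literature.AlgebraicGeometry.AbelianSchemes.TupleIsoAtOfFibreIsoPoints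
import Literature.AlgebraicGeometry.AbelianSchemes.LevelStructureTorsionPointsBasis
import Literature.AlgebraicGeometry.AbelianSchemes.WeilDualityTwoBlockCut
import Literature.AlgebraicGeometry.AbelianSchemes.KernelLagrangianOfDescent
import Literature.AlgebraicGeometry.GroupSchemes.TorsionLayerBlockIdempotents
import Literature.AlgebraicGeometry.GroupSchemes.IsotropicSubgroupEqOfBlockEq
import Literature.AlgebraicGeometry.Motives.AbelianVarietyTorsionFrobeniusPins
import Literature.AlgebraicGeometry.AbelianSchemes.PolarizationUnitHypothesis
import Literature.AlgebraicGeometry.AbelianSchemes.SerreTwistBaseChange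
import Summits.HodgeConjecture.HodgeConjecture.Theorems.F0P6bWDockPackage
import Literature.AlgebraicGeometry.AbelianSchemes.IdealTorsionLayerRank
import Literature.AlgebraicGeometry.HodgeTheory.IntegralModelSpecialPointBlockHeight
import Literature.RingTheory.DedekindDomain.BlockIdempotentFamily
import Literature.AlgebraicGeometry.GroupSchemes.IdealTorsionProductRealisationRank
import Literature.AlgebraicGeometry.GroupSchemes.IdealKernelLayerMapThroughCover
import Literature.AlgebraicGeometry.AbelianSchemes.SerreTranslateCoverLeg
import Literature.AlgebraicGeometry.AbelianSchemes.SerrePresentationOfKernelLaw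
import Literature.AlgebraicGeometry.AbelianSchemes.RoofTranslateComposite
import Literature.AlgebraicGeometry.AbelianSchemes.AbelianSchemeHomReductionSpecialFibreKernel
import Literature.AlgebraicGeometry.AbelianSchemes.SerreTensorRecognitionOfPoints
import Literature.AlgebraicGeometry.AbelianSchemes.AbelianSchemeOverRestrictPt
import Literature.NumberTheory.NumberFields.SerreTensorPresentationOfIdeal
import Literature.AlgebraicGeometry.AbelianSchemes.RoofLegsSpecialFibreKernelRows
import Literature.AlgebraicGeometry.GroupSchemes.ImageIdealOfLayerMap
import Literature.AlgebraicGeometry.GroupSchemes.AffineGroupSchemeHopfAlgebra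
import Literature.AlgebraicGeometry.GroupSchemes.KernelEqOfLagrangianBlocks
import Literature.NumberTheory.NumberFields.GaloisConjugatePrimeIdealArithmetic
import HarnessLib
import HarnessLib.Audit.LibrarySuggestionsDenyListCruxes

/-!
# `F0P6aSpecOrgansBlockC` — ★ RE-HOME of `Lines/F0_P6a_SpecOrgans.lean` (tree sha16 f8c3b4bc8f4404ac, 1249 l.), PART 1 of 5 — tree lines :1–:378
K6 verbatim twin (L2 column; pen LA2-plan (g5) PLAN v1.3 Δ5 cut set of record [379, 611, 902, 1201]; hand LA2-p02 (g5), `mkparts2.py` cand.v3d1.LA2-p02g5): the code below this header is the tree bytes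
of the stated range untouched, namespace KEPT (every fully-qualified name unchanged); later parts re-open the scopes live at their first line with their `open` ∕ `variable` ∕
`universe` ∕ section `set_option` lines replayed verbatim (certified by one-file split rehearsal, LA2-p02 TABLE v2∕v3).  Header canonical per LEAD «M-142a» (A): bare imports only.

(d1) PRE-CURE (LEAD «M-142e» class (d1) «dedup.landed»; LA2-p02 PRE-SCAN 23:2xZ): the tree՚s four by-copy restatements of ★ Literature theorems are DELETED and their ★ homes imported — §QuotWDCore :387–:454 {`comp_eq_one_iff_of_blocks`, `exists_comp_eq_comp_of_equivariant`, `exists_comp_iff_of_dock`} ≡ `Literature.AlgebraicGeometry.GroupSchemes.AffineGroupScheme.*` [`KernelEqOfLagrangianBlocks`] and :1070–:1075 `exists_mem_add_mem_eq_one_of_ne` ≡ `Literature.NumberTheory.NumberFields.*` [`GaloisConjugatePrimeIdealArithmetic`]; the 7 call sites (:674, :762, :766, :1153, :1223, :1267, :1306) spell the landed FQN; line numbers below refer to the cured text (tree minus 75 l. + 2 imports); every other byte is the tree՚s.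
## Import provenance — ★ twin stems (LAST part, plain stem) replacing `Cruxes.HLiu418.Lines` imports: `F0P6aDatumOfInputsDefs` ← `Lines.F0_P6a_DatumOfInputs`;
  `F0P6aRoofKernelCount` ← `Lines.F0_P6a_RoofKernelCount`; `F0P6cHeckeBacktrack` ← `Lines.F0_P6c_HeckeBacktrack`;
  `F0P6aLineSpecialisation` ← `Lines.F0_P6a_LineSpecialisation`.
`import HarnessLib.Audit.LibrarySuggestionsDenyListCruxes` kept on this ROOT part per LEAD «M-142d» «P-κ» (parts 2… inherit it); every other import = the tree list made bare
(the trailing provenance comments of 38 import lines stay in the tree file `Lines/F0_P6a_SpecOrgans.lean` ll. 1–44).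
Original module docstring: reproduced verbatim below this header block (part of the tree bytes :1–:378).  HC_CM is proved only modulo the 7 printed citations (2 remaining: hLiu418 = stmt-HodgeConjecture-24832, h413 = stmt-HodgeConjecture-24833) until rung 0 closes; a re-home is count-neutral.
-/

/-!
# `Lines/F0_P6a_SpecOrgans.lean` ED. 1 — the PAID organ blocks of `stub_SPEC` (HOME cand v2, LA2-p01 (g2), assembly only)

SPLIT (LA2-plan (g2), 2026-09-02 09:5xZ, `ledger crux write` caps a workfile at 200 000 bytes; cand v2 e3f4d4f512983e63 = 224 740 bytes): PART A = THIS FILE = §K §C §I §G §R; PART B = `Lines/F0_P6a_SpecOrgansT.lean` = §T5 §Tα §D6, importing PART A. Every block is byte-identical to cand v2 (boxed GREEN by LAref-D (g0) BOX L2-SPECORGANS #1, leg 550 s); only the file seam is new. The L2 LEAF `Lines/F0_P6a_StubDOWN.lean` ED. 4 imports PART B.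

EDITIONS: ED. 1 (2026-09-02; LA2-plan (g2) DEAL 09:09:13Z «SPECORGANS LEAFLET ED. 1 — CAND ASSEMBLY», geometry 09:03:29Z (2)(d), ruling 09:22:35Z = OPTION (c):
ED. 1 := §K §C §I §G §R §T5 §Tα §D6, all W1-free; §Q (the [WQ] (C6α) fold, incl. (C6α-T)) and W1 `exists_roofMiddleDual₀` ride ED. 2 BY IMPORT of W1-b
`Lines/F0_P6a_StubFROBRoofMiddleDual.lean` together with §L (ρ1𝒞) v3, § J, §φ♭, §C6Ω).  The LS leaflet `Lines/F0_P6a_LineSpecialisation.lean` stays the CURRENCY leaflet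
(ED. 2 served ∕ ED. 3 = (F1) + § LevelCoprime); THIS organ leaflet imports it; the L2 LEAF `Lines/F0_P6a_StubDOWN.lean` ED. 4 imports THIS file and holds §Σ + the organ body.
Namespace `Summit.HodgeConjecture.HodgeConjecture.Cruxes.HLiu418.F0P6aLineSpecialisation` (the LS family namespace — block texts paste unqualified); imports = the served LS
leaflet + the served D-LINE + the served P6c HBT line (consumed by §K) + `Theorems.F0P6bWDockPackage` (consumed by §I) + the UNION of the blocks' ★ imports (tree modules only; no
HOME file, no `Lines.F0_P6a_StubDOWN`, no KillEngine, no (2a)(2b) pack).  Every block below is BYTE-IDENTICAL to its HOME file of record (sha16 in the section banner),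
docstrings kept; the ONLY edits are (a) the DEDUP drops listed next, (b) the file-level `set_option backward.isDefEq.respectTransparency false` of two sources re-scoped to their
blocks, (c) each block wrapped in `section Block_<k>` carrying its source's namespace-level `open`s.
HC_CM is proved only modulo the 7 printed citations (2 remaining: hLiu418 = stmt-HodgeConjecture-24832, h413 = stmt-HodgeConjecture-24833) until rung 0 closes; count-neutral.

DEDUP (one home per helper; dropped copies, BY NAME, with the surviving home):
* `section TranslReduction` of LA6-p01 (g3) `…sec3b.alpha.v3` (8 decls, a copy of LA2-p01's (C5) file)  → §T5 (LA2-p01 `TranslReduction.proof.v1` 5ed88408d12f3be4)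
* `eq_of_pow_eq_pow_of_coprime` (also §Tα's copy in `section CommonSourceAlpha`), `eq_of_comp_eq_of_comp_eq_pow_id`, `comp_eq_of_comp_comp_eq`, `comp_coverInvLeg_eq_one_iff_forall_mem`, `i_comp_coverInvLeg`,
  `exists_untwist_baseChange₂`, `comp_lam_comp_dualIsogenyOver_eq_of_untwist` (LA2-p01 v2 §1–§2) → ★ `Literature/AlgebraicGeometry/AbelianSchemes/SerreTensorUntwistBaseChange` (p850503), imported
  (§Tα's (C3a) `comp_eq_of_pow_rows` resolves `eq_of_pow_eq_pow_of_coprime` to the ★ one through `open … AbelianSchemeOver`).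
BUDGET REPORT: every decl ≤ 400 000 heartbeats (each block's own `set_option maxHeartbeats 400000 in` lines as served); `synthInstance.maxHeartbeats 100000` on A-p06's
`hrkG_of_dock` (§G, as in its HOME file) is the only raised knob (a synthesis budget, ruled fine 09:22:35Z).

## Sections (dependency order)
* §K — (ρ2″∕ρ2‴)-C DATUM v3 — LA2-p03 (g2) `RoofKernelCount.datum.v3` d2af81f90ec7d7e6 (whole `section RoofKernelCount`, byte-identical; uses P6c HBT `exists_line_quotΩ_quotΩ_eq_translΩ_of_hecke_of_hyperspecial` — import kept)
* §C — (C1𝒞)+(C3𝒞) — LA2-p01 (g2) `CommonSourceEngineC.v3` 248e916bb07c03ea §3–§4 (= v2 f9bc9db87a6f7882 §3–§4 byte-identical; §1–§2 = ★ p850503 `SerreTensorUntwistBaseChange`, imported)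
* §I — (C6′) PACK — LA2-p04 (g2) `QuotWDFold.v1` 7115abd15a66e5a8 (§1 LA6-p01 (g2) glue 8d9e7e99 + §1b `rosati_baseChange₀` + §2, byte-identical; file-level `backward.isDefEq.respectTransparency false` re-scoped to this block)
* §G — (RKG) `hrkG_of_dock` — A-p06 (g36) `HrkGOfDock.v1` 1314fd746ca2c107 `section HrkG` (byte-identical; ★ p850494 imported; file-level `backward.isDefEq.respectTransparency false` re-scoped; `synthInstance.maxHeartbeats 100000` on one decl as at HOME)
* §R — (ρ3-K) `exists_isogW₀_of_quotLeg` PACK — LA2-p03 (g3) `IsogW0OfQuotLeg.v1` f3424bb322475ec3 (sections `Helpers` + `IsogW0OfQuotLeg`, byte-identical)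
* §T5 — (C5) `exists_translReduction` — LA2-p01 (g2) `TranslReduction.proof.v1` 5ed88408d12f3be4 §1–§3 (byte-identical)
* §Tα — (C1α)∕(C3a)∕(C3α) + (C4α)∕(T-WD) — LA6-p01 (g3) `LineSpecialisation.sec3b.alpha.v3` ed9770d7ba6ae4f3 `section CommonSourceAlpha` (MINUS `eq_of_pow_eq_pow_of_coprime`, now ★ — lesson 10; v1 leg GREEN with the drop) + `section TranslWDα` (byte-identical); its own `section TranslReduction` copy of §T5 DROPPED — §T5 above is the home
* §D6 — D6 SHEET — LA6-p01 (g3) `QuotQuotSheet.v1` 2673ec94b3615b33 (sections QuotQuotSheet, byte-identical)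
-/

set_option autoImplicit false
set_option linter.dupNamespace false

noncomputable section

universe u

namespace Summit.HodgeConjecture.HodgeConjecture.Cruxes.HLiu418.F0P6aLineSpecialisation

/-! ## §K — (ρ2″∕ρ2‴)-C DATUM lives in its SINGLE HOME `Lines/F0_P6a_RoofKernelCount.lean` (RKC ED. 1 d2af81f9, LA3-plan write 10:18Z; RULE 30):
the 19 §K names (`genΩ`, `actΩROf`, `natCard_roofKernel_eq`, `isIdealTorsionΩ_mul_of_roofLink`, `mem_line_of_forall_pow_of_roofLink`, `roofKernel_stable`, `rosatiΩ`, …) are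
IMPORTED BY NAME (same namespace) — ED. 2 of this leaflet drops the byte-identical `section Block_K` copy of ED. 1 (A-plan2 m21 ∕ lit1 P6L-346 name-clash flag). -/


/-! ## §C — (C1𝒞)+(C3𝒞) — LA2-p01 (g2) `CommonSourceEngineC.v3` 248e916bb07c03ea §3–§4 (= v2 f9bc9db87a6f7882 §3–§4 byte-identical; §1–§2 = ★ p850503 `SerreTensorUntwistBaseChange`, imported) -/

section Block_C

open CategoryTheory CategoryTheory.Limits NumberField IsDedekindDomain MulAction AlgebraicGeometry
open scoped Matrix Polynomial Pointwise MonoidalCategory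
open Literature.NumberTheory.GaloisRepresentations
open Literature.NumberTheory.Automorphic Literature.NumberTheory.Automorphic.UnitaryGroup
open Literature.AlgebraicGeometry.ShimuraVarieties.UnitaryCanonicalModel
open Literature.NumberTheory.Automorphic.Liu2021.AppendixC
open Literature.AlgebraicGeometry.Motives (AlgPoints IntegralModel SchemeOver thickening thickeningGalAction thickeningLift specOver)
open Literature.NumberTheory.DiophantineGeometry (geomResidueField specialFibreFunctor specResidueField)
open Literature.AlgebraicGeometry.RelativeSpec (ActionOver)
open Literature.AlgebraicGeometry.AbelianSchemes Literature.AlgebraicGeometry.AbelianSchemes.AbelianSchemeOver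
open Summit.HodgeConjecture.HodgeConjecture.Cruxes.HLiu418.F0P6aModuliDatumDefs
open Summit.HodgeConjecture.HodgeConjecture.Cruxes.HLiu418.F0P6aRGDAssembly
open Summit.HodgeConjecture.HodgeConjecture.Cruxes.HLiu418.F0P6aDatumOfInputs
open scoped MonObj CategoryTheory.Obj

section SerrePullBack

-- the frame of the D-line՚s `Letters` section VERBATIM
variable {F : Type} [Field F] [NumberField F] [IsCMField F] {ι₁ : F →+* ℂ}
    {Jstar : Matrix (Fin 2) (Fin 2) F}
    {K₀ : C5.OpenCompactSubgroup ↥(finAdelic ↥(maximalRealSubfield F) F (IsCMField.complexConj F) 2 Jstar)}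
    {S : RecordSystemGS F Jstar ι₁ K₀} {hU7ₛ : S.HeckeTranslateDefinedOver}
    {hJ : (Jstar.map (IsCMField.complexConj F))ᵀ = Jstar} {hJu : IsUnit Jstar}
    {Fi : Type} [Field Fi] [Algebra F Fi] {Kc : C5.SmallLevel K₀} {G : Type} [Group G]
    {𝓜 : IntegralModel (𝓞 F) F ((thickening F Fi).obj (S.M.obj Kc))}
    {w : HeightOneSpectrum (𝓞 F)} {hw : (IsCMField.complexConj F) • w ≠ w} {h𝓨 : (𝓜.localise w).IsSmoothProper 1}
    {θ : ActionOver (𝓜.localise w).total.hom ((Fi ≃ₐ[F] Fi) × G)}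
    {e : Fi →ₐ[F] AlgebraicClosure (w.adicCompletion F)}

set_option maxHeartbeats 400000 in
set_option backward.isDefEq.respectTransparency false in
/-- **(C1𝒞-lvl) THE LEVEL POINTS DESCEND ALONG THE UNTWIST.**  At two special points `x̄₁ x̄₂`, for the fibre translations `c̄ᵢ = (ψ_P ×_𝓨 𝓨_s)_{x̄ᵢ} : A_{x̄ᵢ} → 𝒞_{x̄ᵢ}`
and covers `c̄′ᵢ` (`c̄ᵢ ≫ c̄′ᵢ = [p]`): if `g : 𝒞_{x̄₁} → 𝒞_{x̄₂}` carries the translated level point `(σᵃ ≫ ψ_P)(x̄₁)` to `(σᵃ ≫ ψ_P)(x̄₂)` and `f : A_{x̄₁} → A_{x̄₂}` is a homomorphism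
with `c̄₁ ≫ g = f ≫ c̄₂`, then `f(σᵃ(x̄₁)) = σᵃ(x̄₂)` provided `gcd(p, N) = 1`: `u := σᵃ(x̄₁) ≫ f` and `v := σᵃ(x̄₂)` satisfy `u ≫ c̄₂ = σᵃ(x̄₁) ≫ c̄₁ ≫ g = (σᵃ ≫ ψ_P)(x̄₁) ≫ g =
(σᵃ ≫ ψ_P)(x̄₂) = v ≫ c̄₂` (★ `map_coverLeg_restrictPt_sectionBaseChange`, ★ `LevelStructure.baseChange_section_`), and `u^N = v^N = 1` (★ `restrictPt_section_pow_eq_one`), so ★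
`comp_eq_of_comp_comp_eq` applies.  Stated in the ★ `restrictPt`∕`section_` currency of ★ `exists_tupleRel_baseChange_comp_of_iso_of_points` (= `lvlPt₀Of` unfolded).
[cite: MumfordFogartyKirwan1994, Ch. 7 §2 Definition 7.2 (p. 129) and Definition 7.3 (p. 129)] [cite: Conrad2004GrossZagier, §7 (Thm. 7.5)] -/
theorem map_restrictPt_section_eq_of_untwist (I : RGDInputsAt F ι₁ Jstar K₀ S hU7ₛ hJ hJu Fi Kc G 𝓜 w hw h𝓨 θ e)
    {m : ℕ} (E' : Matrix (Fin m) (Fin m) (𝓞 F)) (hE' : E' * E' = E') (P : Matrix (Fin m) (Fin 1) (𝓞 F)) (Q : Matrix (Fin 1) (Fin m) (𝓞 F))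
    (hP : E' * P = P) (hQ : Q * E' = Q) (hQP : Q * P = Matrix.scalar (Fin 1) (I.pChar : 𝓞 F))
    (xbar₁ xbar₂ : AlgPoints (𝓜.localise w).reductionAt (geomResidueField w))
    (g : haveI := I.comm
      (sch₀Of 𝓜 w (serreTensor I.act E' hE') xbar₁).X ⟶ (sch₀Of 𝓜 w (serreTensor I.act E' hE') xbar₂).X)
    (f : (sch₀Of 𝓜 w I.univ xbar₁).X ⟶ (sch₀Of 𝓜 w I.univ xbar₂).X) [IsMonHom f]
    (htr : haveI := I.comm
      baseChangeHom (baseChangeHom (serreTranslate I.act E' hE' P) (pullback.fst (𝓜.localise w).total.hom (specResidueField w)))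
          (xbar₁.left : Spec (CommRingCat.of (geomResidueField w)) ⟶ _) ≫ g =
        f ≫ baseChangeHom (baseChangeHom (serreTranslate I.act E' hE' P) (pullback.fst (𝓜.localise w).total.hom (specResidueField w)))
          (xbar₂.left : Spec (CommRingCat.of (geomResidueField w)) ⟶ _))
    (hlvl : haveI := I.comm
      ∀ a : Fin I.g ⊕ Fin I.g → ZMod I.N,
        AlgPoints.map g
            (((serreTensor I.act E' hE').baseChange (pullback.fst (𝓜.localise w).total.hom (specResidueField w))).restrictPt xbar₁.left
              ((serreTensor I.act E' hE').sectionBaseChange (pullback.fst (𝓜.localise w).total.hom (specResidueField w)) (I.lvl.section_ a ≫ serreTranslate I.act E' hE' P))) =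
          ((serreTensor I.act E' hE').baseChange (pullback.fst (𝓜.localise w).total.hom (specResidueField w))).restrictPt xbar₂.left
            ((serreTensor I.act E' hE').sectionBaseChange (pullback.fst (𝓜.localise w).total.hom (specResidueField w)) (I.lvl.section_ a ≫ serreTranslate I.act E' hE' P)))
    (hpN : Nat.Coprime I.pChar I.N) (a : Fin I.g ⊕ Fin I.g → ZMod I.N) :
    AlgPoints.map f ((I.univ.baseChange (pullback.fst (𝓜.localise w).total.hom (specResidueField w))).restrictPt xbar₁.left
        ((I.lvl.baseChange (pullback.fst (𝓜.localise w).total.hom (specResidueField w))).section_ a)) =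
      (I.univ.baseChange (pullback.fst (𝓜.localise w).total.hom (specResidueField w))).restrictPt xbar₂.left
        ((I.lvl.baseChange (pullback.fst (𝓜.localise w).total.hom (specResidueField w))).section_ a) := by
  haveI := I.comm
  -- `σᵃ(x̄ᵢ) ≫ c̄ᵢ = (σᵃ ≫ ψ_P)(x̄ᵢ)` (★, sections edition), re-read on `(lvl ×_𝓨 𝓨_s).section_ a` (★ `LevelStructure.baseChange_section_`, univ-side only — no search across families)
  have e₁ := congrArg ((I.univ.baseChange (pullback.fst (𝓜.localise w).total.hom (specResidueField w))).restrictPt xbar₁.left)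
    (LevelStructure.baseChange_section_ (pullback.fst (𝓜.localise w).total.hom (specResidueField w)) I.lvl a)
  have e₂ := congrArg ((I.univ.baseChange (pullback.fst (𝓜.localise w).total.hom (specResidueField w))).restrictPt xbar₂.left)
    (LevelStructure.baseChange_section_ (pullback.fst (𝓜.localise w).total.hom (specResidueField w)) I.lvl a)
  have hpt₁ := (congrArg (AlgPoints.map _) e₁).trans
    (map_coverLeg_restrictPt_sectionBaseChange (pullback.fst (𝓜.localise w).total.hom (specResidueField w)) xbar₁.left I.act E' hE' P (I.lvl.section_ a))
  have hpt₂ := (congrArg (AlgPoints.map _) e₂).trans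
    (map_coverLeg_restrictPt_sectionBaseChange (pullback.fst (𝓜.localise w).total.hom (specResidueField w)) xbar₂.left I.act E' hE' P (I.lvl.section_ a))
  -- `c̄₂ ≫ c̄′₂ = [p]`
  have hcc' : baseChangeHom (baseChangeHom (serreTranslate I.act E' hE' P) (pullback.fst (𝓜.localise w).total.hom (specResidueField w)))
        (xbar₂.left : Spec (CommRingCat.of (geomResidueField w)) ⟶ _) ≫
      baseChangeHom (baseChangeHom (serreTranslateInv I.act E' hE' Q) (pullback.fst (𝓜.localise w).total.hom (specResidueField w)))
        (xbar₂.left : Spec (CommRingCat.of (geomResidueField w)) ⟶ _) = (𝟙 _) ^ I.pChar :=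
    baseChangeHom_comp_eq_pow_id_of_comp_eq_pow_id _ _ _
      (baseChangeHom_comp_eq_pow_id_of_comp_eq_pow_id _ _ _ (serreTranslate_comp_serreTranslateInv I.act E' hE' P Q hP hQ hQP))
  -- the sections are `N`-torsion
  haveI : IsCommMonObj (I.univ.baseChange (pullback.fst (𝓜.localise w).total.hom (specResidueField w))).X := isCommMonObj_baseChange _
  have htors₁ := (I.lvl.baseChange (pullback.fst (𝓜.localise w).total.hom (specResidueField w))).restrictPt_section_pow_eq_one xbar₁.left a
  have htors₂ := (I.lvl.baseChange (pullback.fst (𝓜.localise w).total.hom (specResidueField w))).restrictPt_section_pow_eq_one xbar₂.left a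
  -- `(σ₁ ≫ f) ≫ c̄₂ = σ₁ ≫ c̄₁ ≫ g = (σ ≫ ψ_P)(x̄₁) ≫ g = (σ ≫ ψ_P)(x̄₂) = σ₂ ≫ c̄₂`, then ★ `comp_eq_of_comp_comp_eq`
  exact comp_eq_of_comp_comp_eq f _ _ hcc' hpN
    (by
      simp only [Category.assoc, ← htr]
      exact ((Category.assoc _ _ _).symm.trans ((congrArg (· ≫ g) hpt₁).trans (hlvl a))).trans hpt₂.symm)
    htors₁ htors₂

set_option maxHeartbeats 400000 in
set_option backward.isDefEq.respectTransparency false in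
/-- **(C1𝒞) `red₀Of_eq_of_structuredIso₀_serre` — «SERRE PULL-BACK».**  For `I : RGDInputsAt …`, a Serre presentation `(E′, P, Q)` of `𝔭_w⁻¹` with scalar `p = I.pChar` and its cover
package `(𝔠, hQ𝔠, h𝔠)` (★ `exists_serrePresentation_of_ideal_of_natCast_mem`, last two conjuncts, `𝔠 := range Q`), `𝒞 := serreTensor I.act E′ hE′`, and two record points `z₁ z₂`
with special points `x̄ᵢ := red₀ zᵢ`: an isomorphism `ε : 𝒞_{x̄₁} ⥲ 𝒞_{x̄₂}` (`sch₀Of 𝓜 w 𝒞 x̄ᵢ`) with `ε.hom` a homomorphism, (ACT𝒞) intertwining `act₀Of 𝓜 w 𝒞 (serreAction …) a x̄ᵢ`,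
(LVL𝒞) carrying the TRANSLATED level points `(σᵃ ≫ ψ_P)(x̄₁) ↦ (σᵃ ≫ ψ_P)(x̄₂)` (the (ρ1𝒞) (LVL) right-hand sides), and (SIM𝒞) exact, `ε ≫ λ_B̄₂ ≫ ε^∨ = λ_B̄₁`, on a pair of
dual homomorphisms `λ_B̄ᵢ : 𝒞_{x̄ᵢ} → B̄ᵢ^` through which the fibre translations `c̄ᵢ = (ψ_P ×_𝓨 𝓨_s)_{x̄ᵢ}` pull back to `λ_{x̄ᵢ} ≫ [p]` (the (ρ1𝒞) (SIM) premiss VERBATIM; W1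
`exists_roofMiddleDual₀` produces such pairs at every special point), and `gcd(p, N) = 1` (`hpN`, LAST; `coprime_pChar_N_of_specialPoint` at the fold) ⟹ **`red₀ z₁ = red₀ z₂`**.
Proof: ★ `exists_untwist_baseChange₂` (at `g := ι_s`, `sᵢ := x̄ᵢ.left`; the ACT rows are its `hε` by `act₀Of_hom_hom_hom` = `rfl`) gives `f : A_{x̄₁} ⥲ A_{x̄₂}` equivariant with
`c̄₁ ≫ ε = f ≫ c̄₂`; ★ `comp_lam_comp_dualIsogenyOver_eq_of_untwist` makes `f` `λ`-exact (`f^∨` is a homomorphism over the field `κ̄(w)`, ★ `DualPair.isMonHom_dualIsogenyOver` with the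
pins of `pol₀Of`); the level points: `u := σ₁ᵃ ≫ f`, `v := σ₂ᵃ` satisfy `u ≫ c̄₂ = σ₁ᵃ ≫ c̄₁ ≫ ε = (σᵃ ≫ ψ_P)(x̄₁) ≫ ε = (σᵃ ≫ ψ_P)(x̄₂) = v ≫ c̄₂` (★ `map_coverLeg_restrictPt_sectionBaseChange`,
`lvlPt₀Of` unfolded by ★ `LevelStructure.baseChange_section_`), `c̄₂ ≫ c̄′₂ = [p]`, and are `N`-torsion (★ `restrictPt_section_pow_eq_one`), so `u = v` (★
`comp_eq_of_comp_comp_eq`); conclude by (C1α) = `I.inj₀ ∘` ★ `exists_tupleRel_baseChange_comp_of_iso_of_points`.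
[cite: MumfordAV1970, §7 Thm. 4 (p. 72); §15 Thm. 1 (p. 143); §23 (p. 231)] [cite: Conrad2004GrossZagier, §7 (Thm. 7.5)]
[cite: MumfordFogartyKirwan1994, Ch. 7 §2 Definition 7.2 (p. 129), Definition 7.3 (p. 129) and Ch. 7 §3 Theorem 7.9 (p. 139)] -/
theorem red₀Of_eq_of_structuredIso₀_serre (I : RGDInputsAt F ι₁ Jstar K₀ S hU7ₛ hJ hJu Fi Kc G 𝓜 w hw h𝓨 θ e)
    {m : ℕ} (E' : Matrix (Fin m) (Fin m) (𝓞 F)) (hE' : E' * E' = E') (P : Matrix (Fin m) (Fin 1) (𝓞 F)) (Q : Matrix (Fin 1) (Fin m) (𝓞 F))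
    (hP : E' * P = P) (hQ : Q * E' = Q) (hQP : Q * P = Matrix.scalar (Fin 1) (I.pChar : 𝓞 F))
    (hPQ : P * Q = Matrix.scalar (Fin m) (I.pChar : 𝓞 F) * E')
    (𝔠 : Set (𝓞 F)) (hQ𝔠 : ∀ j k, Q j k ∈ 𝔠) (h𝔠 : ∀ a ∈ 𝔠, ∃ Pa : Matrix (Fin m) (Fin 1) (𝓞 F), E' * Pa = Pa ∧ Pa * Q = a • E')
    (z₁ z₂ : AlgPoints (S.M.obj Kc) (AlgebraicClosure (w.adicCompletion F)))
    (ε : haveI := I.comm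
      (sch₀Of 𝓜 w (serreTensor I.act E' hE') (red₀Of S Kc 𝓜 w h𝓨 e z₁)).X ≅ (sch₀Of 𝓜 w (serreTensor I.act E' hE') (red₀Of S Kc 𝓜 w h𝓨 e z₂)).X)
    [IsMonHom ε.hom]
    -- (ACT𝒞) `ε` intertwines the Serre actions (`act₀Of` currency, as in (ρ1𝒞) (ACT))
    (hact : haveI := I.comm
      ∀ a : 𝓞 F, (act₀Of 𝓜 w (serreTensor I.act E' hE') (serreAction I.act E' hE') a (red₀Of S Kc 𝓜 w h𝓨 e z₁)).hom.hom.hom ≫ ε.hom =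
        ε.hom ≫ (act₀Of 𝓜 w (serreTensor I.act E' hE') (serreAction I.act E' hE') a (red₀Of S Kc 𝓜 w h𝓨 e z₂)).hom.hom.hom)
    -- (LVL𝒞) `ε` carries the translated level points (the (ρ1𝒞) (LVL) right-hand sides)
    (hlvl : haveI := I.comm
      ∀ a : Fin I.g ⊕ Fin I.g → ZMod I.N,
        AlgPoints.map ε.hom
            (((serreTensor I.act E' hE').baseChange (pullback.fst (𝓜.localise w).total.hom (specResidueField w))).restrictPt (red₀Of S Kc 𝓜 w h𝓨 e z₁).left
              ((serreTensor I.act E' hE').sectionBaseChange (pullback.fst (𝓜.localise w).total.hom (specResidueField w)) (I.lvl.section_ a ≫ serreTranslate I.act E' hE' P))) =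
          ((serreTensor I.act E' hE').baseChange (pullback.fst (𝓜.localise w).total.hom (specResidueField w))).restrictPt (red₀Of S Kc 𝓜 w h𝓨 e z₂).left
            ((serreTensor I.act E' hE').sectionBaseChange (pullback.fst (𝓜.localise w).total.hom (specResidueField w)) (I.lvl.section_ a ≫ serreTranslate I.act E' hE' P)))
    -- (SIM𝒞) an exact-twist pair on each side (W1 `exists_roofMiddleDual₀` shape = the (ρ1𝒞) (SIM) premiss) on which `ε` is exact
    (DB₁ : haveI := I.comm; (sch₀Of 𝓜 w (serreTensor I.act E' hE') (red₀Of S Kc 𝓜 w h𝓨 e z₁)).DualPair)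
    (lamB₁ : haveI := I.comm; (sch₀Of 𝓜 w (serreTensor I.act E' hE') (red₀Of S Kc 𝓜 w h𝓨 e z₁)).X ⟶ DB₁.hat.X)
    (hex₁ : haveI := I.comm
      haveI := isMonHom_coverLeg (pullback.fst (𝓜.localise w).total.hom (specResidueField w)) (red₀Of S Kc 𝓜 w h𝓨 e z₁).left I.act E' hE' P
      baseChangeHom (baseChangeHom (serreTranslate I.act E' hE' P) (pullback.fst (𝓜.localise w).total.hom (specResidueField w))) (red₀Of S Kc 𝓜 w h𝓨 e z₁).left ≫ lamB₁ ≫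
          DualPair.dualIsogenyOver (baseChangeHom (baseChangeHom (serreTranslate I.act E' hE' P) (pullback.fst (𝓜.localise w).total.hom (specResidueField w))) (red₀Of S Kc 𝓜 w h𝓨 e z₁).left)
            (dual₀Of 𝓜 w I.univ I.dual (red₀Of S Kc 𝓜 w h𝓨 e z₁)) DB₁ =
        (pol₀Of 𝓜 w I.univ I.pol (red₀Of S Kc 𝓜 w h𝓨 e z₁)).lam ≫ (dual₀Of 𝓜 w I.univ I.dual (red₀Of S Kc 𝓜 w h𝓨 e z₁)).hat.mulN I.pChar)
    (DB₂ : haveI := I.comm; (sch₀Of 𝓜 w (serreTensor I.act E' hE') (red₀Of S Kc 𝓜 w h𝓨 e z₂)).DualPair)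
    (lamB₂ : haveI := I.comm; (sch₀Of 𝓜 w (serreTensor I.act E' hE') (red₀Of S Kc 𝓜 w h𝓨 e z₂)).X ⟶ DB₂.hat.X)
    (hex₂ : haveI := I.comm
      haveI := isMonHom_coverLeg (pullback.fst (𝓜.localise w).total.hom (specResidueField w)) (red₀Of S Kc 𝓜 w h𝓨 e z₂).left I.act E' hE' P
      baseChangeHom (baseChangeHom (serreTranslate I.act E' hE' P) (pullback.fst (𝓜.localise w).total.hom (specResidueField w))) (red₀Of S Kc 𝓜 w h𝓨 e z₂).left ≫ lamB₂ ≫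
          DualPair.dualIsogenyOver (baseChangeHom (baseChangeHom (serreTranslate I.act E' hE' P) (pullback.fst (𝓜.localise w).total.hom (specResidueField w))) (red₀Of S Kc 𝓜 w h𝓨 e z₂).left)
            (dual₀Of 𝓜 w I.univ I.dual (red₀Of S Kc 𝓜 w h𝓨 e z₂)) DB₂ =
        (pol₀Of 𝓜 w I.univ I.pol (red₀Of S Kc 𝓜 w h𝓨 e z₂)).lam ≫ (dual₀Of 𝓜 w I.univ I.dual (red₀Of S Kc 𝓜 w h𝓨 e z₂)).hat.mulN I.pChar)
    (hlam : ε.hom ≫ lamB₂ ≫ DualPair.dualIsogenyOver ε.hom DB₁ DB₂ = lamB₁)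
    (hpN : Nat.Coprime I.pChar I.N) :
    red₀Of S Kc 𝓜 w h𝓨 e z₁ = red₀Of S Kc 𝓜 w h𝓨 e z₂ := by
  haveI := I.comm
  have hp0 : I.pChar ≠ 0 := I.hpChar.1.ne_zero
  -- ★ UNTWIST — `f : A_{x̄₁} ⥲ A_{x̄₂}`, equivariant, `c̄₁ ≫ ε = f ≫ c̄₂` (the ACT rows are `hε` by `rfl`, `act₀Of_hom_hom_hom`)
  obtain ⟨f, hfmon, hequiv, -, htr⟩ := exists_untwist_baseChange₂ (Y'' := Spec (CommRingCat.of (geomResidueField w)))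
    (pullback.fst (𝓜.localise w).total.hom (specResidueField w)) I.act E' hE' P Q
    (red₀Of S Kc 𝓜 w h𝓨 e z₁).left (red₀Of S Kc 𝓜 w h𝓨 e z₂).left hp0 hP hQ hQP hPQ 𝔠 hQ𝔠 h𝔠 ε hact
  haveI := hfmon
  -- the λ-EXACTNESS of `f` (★)
  haveI := isMonHom_coverLeg (pullback.fst (𝓜.localise w).total.hom (specResidueField w)) (red₀Of S Kc 𝓜 w h𝓨 e z₁).left I.act E' hE' P
  haveI := isMonHom_coverLeg (pullback.fst (𝓜.localise w).total.hom (specResidueField w)) (red₀Of S Kc 𝓜 w h𝓨 e z₂).left I.act E' hE' P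
  haveI := (pol₀Of 𝓜 w I.univ I.pol (red₀Of S Kc 𝓜 w h𝓨 e z₁)).isMonHom
  haveI := (pol₀Of 𝓜 w I.univ I.pol (red₀Of S Kc 𝓜 w h𝓨 e z₂)).isMonHom
  haveI : IsMonHom (DualPair.dualIsogenyOver f.hom (dual₀Of 𝓜 w I.univ I.dual (red₀Of S Kc 𝓜 w h𝓨 e z₁)) (dual₀Of 𝓜 w I.univ I.dual (red₀Of S Kc 𝓜 w h𝓨 e z₂))) :=
    DualPair.isMonHom_dualIsogenyOver (S := Spec (CommRingCat.of (geomResidueField w))) f.hom _ _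
      (pol₀Of 𝓜 w I.univ I.pol (red₀Of S Kc 𝓜 w h𝓨 e z₂)).nonempty_unitHatSlice_iso (pol₀Of 𝓜 w I.univ I.pol (red₀Of S Kc 𝓜 w h𝓨 e z₁)).nonempty_unitHatSlice_iso
  have hlam' := comp_lam_comp_dualIsogenyOver_eq_of_untwist _ _ ε f htr
    (dual₀Of 𝓜 w I.univ I.dual (red₀Of S Kc 𝓜 w h𝓨 e z₁)) (dual₀Of 𝓜 w I.univ I.dual (red₀Of S Kc 𝓜 w h𝓨 e z₂)) DB₁ DB₂
    (pol₀Of 𝓜 w I.univ I.pol (red₀Of S Kc 𝓜 w h𝓨 e z₁)).lam (pol₀Of 𝓜 w I.univ I.pol (red₀Of S Kc 𝓜 w h𝓨 e z₂)).lam lamB₁ lamB₂ hp0 hex₁ hex₂ hlam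
  -- the LEVEL points (C1𝒞-lvl) and the conclusion by (C1α) = `I.inj₀` ∘ ★ `exists_tupleRel_baseChange_comp_of_iso_of_points`
  exact I.inj₀ z₁ z₂ (exists_tupleRel_baseChange_comp_of_iso_of_points I.univ I.act I.dual I.pol I.lvl
    (pullback.fst (𝓜.localise w).total.hom (specResidueField w)) (red₀Of S Kc 𝓜 w h𝓨 e z₁).left (red₀Of S Kc 𝓜 w h𝓨 e z₂).left f hlam'
    (map_restrictPt_section_eq_of_untwist I E' hE' P Q hP hQ hQP _ _ ε.hom f.hom htr hlvl hpN) hequiv)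

end SerrePullBack

section CommonSourceSerre

-- the frame of the D-line՚s `Letters` section VERBATIM
variable {F : Type} [Field F] [NumberField F] [IsCMField F] {ι₁ : F →+* ℂ}
    {Jstar : Matrix (Fin 2) (Fin 2) F}
    {K₀ : C5.OpenCompactSubgroup ↥(finAdelic ↥(maximalRealSubfield F) F (IsCMField.complexConj F) 2 Jstar)}
    {S : RecordSystemGS F Jstar ι₁ K₀} {hU7ₛ : S.HeckeTranslateDefinedOver}
    {hJ : (Jstar.map (IsCMField.complexConj F))ᵀ = Jstar} {hJu : IsUnit Jstar}
    {Fi : Type} [Field Fi] [Algebra F Fi] {Kc : C5.SmallLevel K₀} {G : Type} [Group G]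
    {𝓜 : IntegralModel (𝓞 F) F ((thickening F Fi).obj (S.M.obj Kc))}
    {w : HeightOneSpectrum (𝓞 F)} {hw : (IsCMField.complexConj F) • w ≠ w} {h𝓨 : (𝓜.localise w).IsSmoothProper 1}
    {θ : ActionOver (𝓜.localise w).total.hom ((Fi ≃ₐ[F] Fi) × G)}
    {e : Fi →ₐ[F] AlgebraicClosure (w.adicCompletion F)}

set_option maxHeartbeats 400000 in
set_option backward.isDefEq.respectTransparency false in
/-- **(C3𝒞) `red₀Of_eq_of_common_source_serre` — TWO `𝒞`-LEGS OUT OF ONE SPECIAL FIBRE WITH THE SAME KERNEL HAVE THE SAME TARGET POINT.**  For `I`, a Serre presentation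
`(E′, P, Q)` of `𝔭_w⁻¹` with scalar `p` and cover package `(𝔠, hQ𝔠, h𝔠)`, a special point `x̄` (the common source `A_{x̄} = sch₀Of 𝓜 w I.univ x̄`) and two record points `z₁ z₂`
(targets `𝒞_{red₀ zᵢ}`): two homomorphisms `ψᵢ : A_{x̄} → 𝒞_{red₀ zᵢ}` carrying the (ρ1𝒞) rows VERBATIM — (FLAT-SURJ)ᵢ, (ACT)ᵢ, (LVL)ᵢ, and (SIM)ᵢ INSTANTIATED at an exact-twist
pair `(DB̄ᵢ, pinᵢ, λ_B̄ᵢ, hexᵢ)` of `𝒞_{red₀ zᵢ}` (W1 `exists_roofMiddleDual₀ I E′ … (red₀ zᵢ)`; the consumer applies the (ρ1𝒞) ∀-(SIM) row to it) — with (KER) THE SAME KERNEL on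
all `T`-points ((C6′) `comp_eq_one_iff_of_two_quotLegs`), and `gcd(p, N) = 1` LAST ⟹ **`red₀ z₁ = red₀ z₂`**.  Proof: the legs are finite (finitely many kernel points by (SIM)ᵢ, ★
`finite_setOf_map_eq_one_of_pullback_polarization`, + surjective, ★ `isFinite_left_of_surjective_of_finite_setOf_map_eq_one`); ★ (TW) `roof_target_unique` gives `ε : 𝒞_{red₀ z₁} ⥲
𝒞_{red₀ z₂}` with `ψ₁ ≫ ε = ψ₂`, exact on `(λ_B̄₁, λ_B̄₂)`, intertwining the Serre actions ((r4′) fed by (ACT)ᵢ) and carrying `(σᵃ ≫ ψ_P)(red₀ z₁) = ψ₁(σᵃ(x̄)) ↦ ψ₂(σᵃ(x̄)) =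
(σᵃ ≫ ψ_P)(red₀ z₂)` ((r5′) + (LVL)ᵢ); then (C1𝒞) `red₀Of_eq_of_structuredIso₀_serre`.  The [WQ] fold (LA2-p04 (g2)) is this theorem after transport by the equation binder.
[cite: MumfordAV1970, §7 Thm. 4 (p. 72); §19 Thm. 1 (p. 173); §23 (p. 231)] [cite: MumfordFogartyKirwan1994, Ch. 7 §2 Definition 7.2 (p. 129) and Ch. 7 §3 Theorem 7.9 (p. 139)]
[cite: Liu2021, Prop. D.8 (2)(3) p. 135, pp. 136–138] [cite: Conrad2004GrossZagier, §7 (Thm. 7.5)] -/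
theorem red₀Of_eq_of_common_source_serre (I : RGDInputsAt F ι₁ Jstar K₀ S hU7ₛ hJ hJu Fi Kc G 𝓜 w hw h𝓨 θ e)
    {m : ℕ} (E' : Matrix (Fin m) (Fin m) (𝓞 F)) (hE' : E' * E' = E') (P : Matrix (Fin m) (Fin 1) (𝓞 F)) (Q : Matrix (Fin 1) (Fin m) (𝓞 F))
    (hP : E' * P = P) (hQ : Q * E' = Q) (hQP : Q * P = Matrix.scalar (Fin 1) (I.pChar : 𝓞 F))
    (hPQ : P * Q = Matrix.scalar (Fin m) (I.pChar : 𝓞 F) * E')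
    (𝔠 : Set (𝓞 F)) (hQ𝔠 : ∀ j k, Q j k ∈ 𝔠) (h𝔠 : ∀ a ∈ 𝔠, ∃ Pa : Matrix (Fin m) (Fin 1) (𝓞 F), E' * Pa = Pa ∧ Pa * Q = a • E')
    (xbar : AlgPoints (𝓜.localise w).reductionAt (geomResidueField w))
    (z₁ z₂ : AlgPoints (S.M.obj Kc) (AlgebraicClosure (w.adicCompletion F)))
    (ψ₁ : haveI := I.comm; (sch₀Of 𝓜 w I.univ xbar).X ⟶ (sch₀Of 𝓜 w (serreTensor I.act E' hE') (red₀Of S Kc 𝓜 w h𝓨 e z₁)).X) [IsMonHom ψ₁]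
    (ψ₂ : haveI := I.comm; (sch₀Of 𝓜 w I.univ xbar).X ⟶ (sch₀Of 𝓜 w (serreTensor I.act E' hE') (red₀Of S Kc 𝓜 w h𝓨 e z₂)).X) [IsMonHom ψ₂]
    -- (FLAT-SURJ)ᵢ VERBATIM
    (hfs₁ : Flat ψ₁.left ∧ Function.Surjective ψ₁.left.base) (hfs₂ : Flat ψ₂.left ∧ Function.Surjective ψ₂.left.base)
    -- (ACT)ᵢ VERBATIM
    (hact₁ : haveI := I.comm
      ∀ a : 𝓞 F, (act₀Of 𝓜 w I.univ I.act a xbar).hom.hom.hom ≫ ψ₁ =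
        ψ₁ ≫ (act₀Of 𝓜 w (serreTensor I.act E' hE') (serreAction I.act E' hE') a (red₀Of S Kc 𝓜 w h𝓨 e z₁)).hom.hom.hom)
    (hact₂ : haveI := I.comm
      ∀ a : 𝓞 F, (act₀Of 𝓜 w I.univ I.act a xbar).hom.hom.hom ≫ ψ₂ =
        ψ₂ ≫ (act₀Of 𝓜 w (serreTensor I.act E' hE') (serreAction I.act E' hE') a (red₀Of S Kc 𝓜 w h𝓨 e z₂)).hom.hom.hom)
    -- (LVL)ᵢ VERBATIM
    (hlvl₁ : haveI := I.comm
      ∀ a : Fin I.g ⊕ Fin I.g → ZMod I.N,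
        AlgPoints.map ψ₁ (lvlPt₀Of 𝓜 w I.univ I.lvl xbar a) =
          ((serreTensor I.act E' hE').baseChange (pullback.fst (𝓜.localise w).total.hom (specResidueField w))).restrictPt (red₀Of S Kc 𝓜 w h𝓨 e z₁).left
            ((serreTensor I.act E' hE').sectionBaseChange (pullback.fst (𝓜.localise w).total.hom (specResidueField w)) (I.lvl.section_ a ≫ serreTranslate I.act E' hE' P)))
    (hlvl₂ : haveI := I.comm
      ∀ a : Fin I.g ⊕ Fin I.g → ZMod I.N,
        AlgPoints.map ψ₂ (lvlPt₀Of 𝓜 w I.univ I.lvl xbar a) =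
          ((serreTensor I.act E' hE').baseChange (pullback.fst (𝓜.localise w).total.hom (specResidueField w))).restrictPt (red₀Of S Kc 𝓜 w h𝓨 e z₂).left
            ((serreTensor I.act E' hE').sectionBaseChange (pullback.fst (𝓜.localise w).total.hom (specResidueField w)) (I.lvl.section_ a ≫ serreTranslate I.act E' hE' P)))
    -- (KER) the same kernel on ALL `T`-points ((C6′))
    (hker : ∀ ⦃T : SchemeOver (geomResidueField w)⦄ (t : T ⟶ (sch₀Of 𝓜 w I.univ xbar).X), t ≫ ψ₁ = 1 ↔ t ≫ ψ₂ = 1)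
    -- the exact-twist pairs (W1 `exists_roofMiddleDual₀` at `red₀ zᵢ`) and (SIM)ᵢ instantiated at them
    (DB₁ : haveI := I.comm; (sch₀Of 𝓜 w (serreTensor I.act E' hE') (red₀Of S Kc 𝓜 w h𝓨 e z₁)).DualPair)
    (hDB₁ : Nonempty ((Scheme.Modules.pullback (DualPair.unitHatSlice DB₁)).obj DB₁.P ≅ SheafOfModules.unit _))
    (lamB₁ : haveI := I.comm; (sch₀Of 𝓜 w (serreTensor I.act E' hE') (red₀Of S Kc 𝓜 w h𝓨 e z₁)).X ⟶ DB₁.hat.X) [IsMonHom lamB₁]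
    (hex₁ : haveI := I.comm
      haveI := isMonHom_coverLeg (pullback.fst (𝓜.localise w).total.hom (specResidueField w)) (red₀Of S Kc 𝓜 w h𝓨 e z₁).left I.act E' hE' P
      baseChangeHom (baseChangeHom (serreTranslate I.act E' hE' P) (pullback.fst (𝓜.localise w).total.hom (specResidueField w))) (red₀Of S Kc 𝓜 w h𝓨 e z₁).left ≫ lamB₁ ≫
          DualPair.dualIsogenyOver (baseChangeHom (baseChangeHom (serreTranslate I.act E' hE' P) (pullback.fst (𝓜.localise w).total.hom (specResidueField w))) (red₀Of S Kc 𝓜 w h𝓨 e z₁).left)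
            (dual₀Of 𝓜 w I.univ I.dual (red₀Of S Kc 𝓜 w h𝓨 e z₁)) DB₁ =
        (pol₀Of 𝓜 w I.univ I.pol (red₀Of S Kc 𝓜 w h𝓨 e z₁)).lam ≫ (dual₀Of 𝓜 w I.univ I.dual (red₀Of S Kc 𝓜 w h𝓨 e z₁)).hat.mulN I.pChar)
    (hsim₁ : haveI := I.comm
      ψ₁ ≫ lamB₁ ≫ DualPair.dualIsogenyOver ψ₁ (dual₀Of 𝓜 w I.univ I.dual xbar) DB₁ =
        (pol₀Of 𝓜 w I.univ I.pol xbar).lam ≫ (dual₀Of 𝓜 w I.univ I.dual xbar).hat.mulN I.pChar)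
    (DB₂ : haveI := I.comm; (sch₀Of 𝓜 w (serreTensor I.act E' hE') (red₀Of S Kc 𝓜 w h𝓨 e z₂)).DualPair)
    (hDB₂ : Nonempty ((Scheme.Modules.pullback (DualPair.unitHatSlice DB₂)).obj DB₂.P ≅ SheafOfModules.unit _))
    (lamB₂ : haveI := I.comm; (sch₀Of 𝓜 w (serreTensor I.act E' hE') (red₀Of S Kc 𝓜 w h𝓨 e z₂)).X ⟶ DB₂.hat.X) [IsMonHom lamB₂]
    (hex₂ : haveI := I.comm
      haveI := isMonHom_coverLeg (pullback.fst (𝓜.localise w).total.hom (specResidueField w)) (red₀Of S Kc 𝓜 w h𝓨 e z₂).left I.act E' hE' P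
      baseChangeHom (baseChangeHom (serreTranslate I.act E' hE' P) (pullback.fst (𝓜.localise w).total.hom (specResidueField w))) (red₀Of S Kc 𝓜 w h𝓨 e z₂).left ≫ lamB₂ ≫
          DualPair.dualIsogenyOver (baseChangeHom (baseChangeHom (serreTranslate I.act E' hE' P) (pullback.fst (𝓜.localise w).total.hom (specResidueField w))) (red₀Of S Kc 𝓜 w h𝓨 e z₂).left)
            (dual₀Of 𝓜 w I.univ I.dual (red₀Of S Kc 𝓜 w h𝓨 e z₂)) DB₂ =
        (pol₀Of 𝓜 w I.univ I.pol (red₀Of S Kc 𝓜 w h𝓨 e z₂)).lam ≫ (dual₀Of 𝓜 w I.univ I.dual (red₀Of S Kc 𝓜 w h𝓨 e z₂)).hat.mulN I.pChar)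
    (hsim₂ : haveI := I.comm
      ψ₂ ≫ lamB₂ ≫ DualPair.dualIsogenyOver ψ₂ (dual₀Of 𝓜 w I.univ I.dual xbar) DB₂ =
        (pol₀Of 𝓜 w I.univ I.pol xbar).lam ≫ (dual₀Of 𝓜 w I.univ I.dual xbar).hat.mulN I.pChar)
    (hpN : Nat.Coprime I.pChar I.N) :
    red₀Of S Kc 𝓜 w h𝓨 e z₁ = red₀Of S Kc 𝓜 w h𝓨 e z₂ := by
  haveI := I.comm
  have hp0 : I.pChar ≠ 0 := I.hpChar.1.ne_zero
  -- the legs are ISOGENIES: surjective by (FLAT-SURJ), finitely many kernel points by (SIM)ᵢ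
  haveI : Surjective ψ₁.left := ⟨hfs₁.2⟩
  haveI : Surjective ψ₂.left := ⟨hfs₂.2⟩
  have hDs := (pol₀Of 𝓜 w I.univ I.pol xbar).nonempty_unitHatSlice_iso
  haveI : IsFinite ψ₁.left := isFinite_left_of_surjective_of_finite_setOf_map_eq_one ψ₁
    (finite_setOf_map_eq_one_of_pullback_polarization (I.dual.baseChange (pullback.fst (𝓜.localise w).total.hom (specResidueField w)))
      (I.pol.baseChange (pullback.fst (𝓜.localise w).total.hom (specResidueField w))) xbar.left DB₁ hDB₁ hDs ψ₁ lamB₁ hp0 hsim₁)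
  haveI : IsFinite ψ₂.left := isFinite_left_of_surjective_of_finite_setOf_map_eq_one ψ₂
    (finite_setOf_map_eq_one_of_pullback_polarization (I.dual.baseChange (pullback.fst (𝓜.localise w).total.hom (specResidueField w)))
      (I.pol.baseChange (pullback.fst (𝓜.localise w).total.hom (specResidueField w))) xbar.left DB₂ hDB₂ hDs ψ₂ lamB₂ hp0 hsim₂)
  -- ★ (TW): the recognition isomorphism `ε : 𝒞_{red₀ z₁} ⥲ 𝒞_{red₀ z₂}`, exact, intertwining, `ψ₁ ≫ ε = ψ₂`
  obtain ⟨ε, hmon, -, -, hlam, hr4, hr5⟩ := roof_target_unique (dual₀Of 𝓜 w I.univ I.dual xbar) DB₁ DB₂ hDB₁ hDB₂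
    (pol₀Of 𝓜 w I.univ I.pol xbar).lam lamB₁ lamB₂ ψ₁ ψ₂ I.pChar hker hsim₁ hsim₂
  haveI := hmon
  -- (C1𝒞)
  refine red₀Of_eq_of_structuredIso₀_serre I E' hE' P Q hP hQ hQP hPQ 𝔠 hQ𝔠 h𝔠 z₁ z₂ ε
    (fun a => hr4 _ _ _ (hact₁ a) (hact₂ a)) (fun a => ?_) DB₁ lamB₁ hex₁ DB₂ lamB₂ hex₂ hlam hpN
  -- (LVL𝒞): `ε((σᵃ ≫ ψ_P)(red₀ z₁)) = ε(ψ₁(σᵃ(x̄))) = ψ₂(σᵃ(x̄)) = (σᵃ ≫ ψ_P)(red₀ z₂)`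
  exact (congrArg (AlgPoints.map ε.hom) (hlvl₁ a)).symm.trans ((hr5 (lvlPt₀Of 𝓜 w I.univ I.lvl xbar a)).trans (hlvl₂ a))

end CommonSourceSerre

end Block_C

end Summit.HodgeConjecture.HodgeConjecture.Cruxes.HLiu418.F0P6aLineSpecialisation

end
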